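import Summits.NavierStokesRegularity.NavierStokesRegularity.Theorems.TypeIIInviscidRelaxationAxisymSwirlRegularCoreReynoldsTwoLevel
import Summits.NavierStokesRegularity.NavierStokesRegularity.Theorems.TypeIIInviscidRelaxationAxisymSwirlRegularOffAxisBound
import Summits.NavierStokesRegularity.NavierStokesRegularity.Theorems.TypeIIInviscidRelaxationAxisymSwirlRegularSplitTightness
import Summits.NavierStokesRegularity.NavierStokesRegularity.Theorems.ScenarioCensusRowF5lgGate
import HarnessLib

/-!
# Core-strain form of the one-sided radial criterion: under an inflow Reynolds gate of ANY size,
# blow-up needs Type-I-rate radial compression inside the parabolic core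

Helper toward the crux `AxisymSwirlRegular` (stmt-NavierStokesRegularity-1964, route TypeIIInviscidRelaxation),
criterion side of the registered line `radial_inflow_split` (stub `stub_oneSidedRadialCriterion`, ⟨19059⟩:
`r u_r ≥ −Cν` on an axis tube for SOME `C` ⇒ continuation; the tree has it for `C < 2`
(`ScenarioCensus.LogGate.oneSidedRadialCriterion_of_lt_two`) and reduces it to its open half `C ≥ 2`
(`ScenarioCensus.LogGate.oneSidedRadialCriterion_iff_geTwo`)).

The landed two-level gate (`RadialInflowCoreReynolds.exists_coreWidth_twoLevelReynolds`: inflow Reynolds number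
`−r u_r/ν ≤ d₀ < 2` on the parabolic core `{r < ξ₀ √(ν(T−t))}`, `≤ Λ₀` outside, ⇒ extension) is read here in the
velocity-GRADIENT currency of blow-up rates.  Inside the parabolic core the subcritical Reynolds bound is
IMPLIED by a one-sided bound on the radial strain `−u_r/r ≤ κ₀/(T−t)` (because `r² < ξ₀² ν (T−t)` there), and a
fortiori by a Type-I bound `‖∇u(t,x)‖ ≤ κ₀/(T−t)` on the core (`|u_r| ≤ r‖∇u‖` for axisymmetric fields,
`ScenarioCensus.LogGate.abs_radialVelocity_le_mul_norm_fderiv`), with the explicit `κ₀ = 1/ξ₀(1, Λ₀)²`: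

* `exists_coreWidth_strainRate` — for every `Λ₀ > 0` there are `ξ₀, κ₀ > 0` such that: gate `u_r ≥ −νΛ₀/r` on the
  unit tube + one-sided radial strain `u_r ≥ −κ₀ r/(T−t)` on the parabolic core ⇒ `HasSmoothExtensionPast`;
* `exists_coreWidth_gradientRate` — the same with the core hypothesis `‖fderiv ℝ (u t) x‖ ≤ κ₀/(T−t)`;
* `oneSidedRadialCriterion_of_coreStrain` / `…_of_coreGradient` — the same two criteria written on the EXACT
  hypothesis list of the stub (standing class + `∃ C δ, r u_r ≥ −Cν` on `{cylRadius < δ}`, ANY `C`): the gate is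
  extended from the `δ`-tube to the unit tube by the off-axis bound `offAxisBound` (CKN), so the constants
  `ξ₀, κ₀` then depend on the solution through that bound;
* `exists_coreCompression_of_not_hasSmoothExtensionPast` — the blow-up reading: in the stub's class, under its
  gate, a solution which does NOT extend past `T` has, at some time `t < T` and some point of the parabolic core
  `0 < r < ξ₀√(ν(T−t))`, `r ≤ 1`, radial compression `−u_r/r > κ₀/(T−t)` and `‖∇u(t,x)‖ > κ₀/(T−t)`.

So in the open regime `C ≥ 2` the obstruction is localised: supercritical inflow Reynolds numbers are harmless unless
they come with Type-I-rate (constant `κ₀(C, u)`) one-sided radial compression INSIDE the parabolic core around the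
axis.  A CRITERION and its contrapositive; constants in the stub-currency versions depend on the solution; nothing
here proves `stub_oneSidedRadialCriterion`, `AxisymSwirlRegular` or NavierStokesRegularity. [new]
-/

noncomputable section

set_option linter.dupNamespace false

open Set Filter Topology Real
open Literature.Analysis.FluidPDE

namespace Summit.NavierStokesRegularity.NavierStokesRegularity.Theorems.RadialInflowCoreStrain

open Summit.NavierStokesRegularity.NavierStokesRegularity.Theorems
open Summit.NavierStokesRegularity.NavierStokesRegularity.Theorems.RadialInflowCoreReynolds
open Summit.NavierStokesRegularity.NavierStokesRegularity.Theorems.ScenarioCensus.LogGate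

/-! ## §1 Explicit-gate versions (constants depend only on the gate `Λ₀`) -/

/-- **Core-strain criterion.** For every `Λ₀ > 0` there are a core width `ξ₀ > 0` and a rate constant `κ₀ > 0`
(`ξ₀ = ξ₀(1, Λ₀)` of the two-level gate, `κ₀ = 1/ξ₀²`) such that, for all `ν, T > 0` and every classical solution
on `[0,T)` at viscosity `ν`, Leray–Hopf from a rapidly decaying datum, with axisymmetric slices: if on the unit tube
`0 < r ≤ 1` the inflow Reynolds number is at most `Λ₀` (`u_r ≥ −νΛ₀/r`) and on the parabolic core
`{r < ξ₀ √(ν(T−t))}` of the unit tube the one-sided radial strain bound `u_r ≥ −κ₀ r/(T−t)` holds, then the solution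
extends smoothly past `T`.  Proof: in the core `κ₀ r/(T−t) = r/(ξ₀²(T−t)) ≤ ν/r` since `r² < ξ₀² ν (T−t)`, so the
Reynolds number there is `≤ 1 < 2`, and `exists_coreWidth_twoLevelReynolds` (`d₀ = 1`) applies. [new] -/
theorem exists_coreWidth_strainRate {Λ₀ : ℝ} (hΛ : 0 < Λ₀) :
    ∃ ξ₀ κ₀ : ℝ, 0 < ξ₀ ∧ 0 < κ₀ ∧ ∀ (ν T : ℝ), 0 < ν → 0 < T →
      ∀ (u : ℝ → EuclideanSpace ℝ (Fin 3) → EuclideanSpace ℝ (Fin 3)) (p : ℝ → EuclideanSpace ℝ (Fin 3) → ℝ),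
      IsClassicalNSSolutionOn (Ico 0 T) ν 0 u p → IsLerayHopfOn T ν 0 (u 0) u → HasRapidSpatialDecay (u 0) →
      (∀ t ∈ Ico 0 T, IsAxisymmetric (u t)) →
      (∀ t ∈ Ico 0 T, ∀ x : EuclideanSpace ℝ (Fin 3), 0 < cylRadius x → cylRadius x ≤ 1 →
        -(ν * Λ₀ / cylRadius x) ≤ radialVelocity (u t) x) →
      (∀ t ∈ Ico 0 T, ∀ x : EuclideanSpace ℝ (Fin 3), 0 < cylRadius x → cylRadius x ≤ 1 →
        cylRadius x < ξ₀ * √(ν * (T - t)) → -(κ₀ * cylRadius x / (T - t)) ≤ radialVelocity (u t) x) →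
      HasSmoothExtensionPast ν 0 u T := by
  obtain ⟨ξ₀, hξ₀, H⟩ := exists_coreWidth_twoLevelReynolds (d₀ := 1) (Λ₀ := Λ₀) one_pos one_lt_two hΛ
  refine ⟨ξ₀, 1 / ξ₀ ^ 2, hξ₀, by positivity, fun ν T hν hT u p hcl hLH hdec hax hgate hstrain => ?_⟩
  refine H ν T hν hT u p hcl hLH hdec hax (fun t ht x hx hx1 hcore => ?_)
    (fun t ht x hx hx1 _ => hgate t ht x hx hx1)
  -- in the core: `u_r ≥ -(κ₀ r/(T-t)) ≥ -(ν/r)`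
  have hs : 0 < T - t := by linarith [ht.2]
  have hνs : 0 < ν * (T - t) := mul_pos hν hs
  have h1 := hstrain t ht x hx hx1 hcore
  have hsq : cylRadius x ^ 2 < ξ₀ ^ 2 * (ν * (T - t)) := by
    have h2 : cylRadius x ^ 2 < (ξ₀ * √(ν * (T - t))) ^ 2 :=
      pow_lt_pow_left₀ hcore (cylRadius_nonneg x) two_ne_zero
    rwa [mul_pow, Real.sq_sqrt hνs.le] at h2
  have h3 : 1 / ξ₀ ^ 2 * cylRadius x / (T - t) ≤ ν * 1 / cylRadius x := by
    rw [div_le_div_iff₀ hs hx]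
    have h4 : 1 / ξ₀ ^ 2 * cylRadius x * cylRadius x = cylRadius x ^ 2 / ξ₀ ^ 2 := by
      field_simp
    rw [h4, div_le_iff₀ (by positivity : (0 : ℝ) < ξ₀ ^ 2)]
    nlinarith
  linarith

/-- **Core-gradient criterion** (Type-I rate on the velocity gradient, needed only inside the parabolic core).
For every `Λ₀ > 0` there are `ξ₀, κ₀ > 0` such that in the class of `exists_coreWidth_strainRate`: the gate
`u_r ≥ −νΛ₀/r` on the unit tube together with `‖∇u(t,x)‖ ≤ κ₀/(T−t)` at the points of the parabolic core
`{0 < r < ξ₀√(ν(T−t)), r ≤ 1}` implies smooth extension past `T`.  Proof: for an axisymmetric `C¹` slice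
`|u_r(x)| ≤ r ‖∇u(x)‖` (`LogGate.abs_radialVelocity_le_mul_norm_fderiv`), so the gradient bound gives the core
strain bound of `exists_coreWidth_strainRate`. [new] -/
theorem exists_coreWidth_gradientRate {Λ₀ : ℝ} (hΛ : 0 < Λ₀) :
    ∃ ξ₀ κ₀ : ℝ, 0 < ξ₀ ∧ 0 < κ₀ ∧ ∀ (ν T : ℝ), 0 < ν → 0 < T →
      ∀ (u : ℝ → EuclideanSpace ℝ (Fin 3) → EuclideanSpace ℝ (Fin 3)) (p : ℝ → EuclideanSpace ℝ (Fin 3) → ℝ),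
      IsClassicalNSSolutionOn (Ico 0 T) ν 0 u p → IsLerayHopfOn T ν 0 (u 0) u → HasRapidSpatialDecay (u 0) →
      (∀ t ∈ Ico 0 T, IsAxisymmetric (u t)) →
      (∀ t ∈ Ico 0 T, ∀ x : EuclideanSpace ℝ (Fin 3), 0 < cylRadius x → cylRadius x ≤ 1 →
        -(ν * Λ₀ / cylRadius x) ≤ radialVelocity (u t) x) →
      (∀ t ∈ Ico 0 T, ∀ x : EuclideanSpace ℝ (Fin 3), 0 < cylRadius x → cylRadius x ≤ 1 →
        cylRadius x < ξ₀ * √(ν * (T - t)) → ‖fderiv ℝ (u t) x‖ ≤ κ₀ / (T - t)) →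
      HasSmoothExtensionPast ν 0 u T := by
  obtain ⟨ξ₀, κ₀, hξ₀, hκ₀, H⟩ := exists_coreWidth_strainRate hΛ
  refine ⟨ξ₀, κ₀, hξ₀, hκ₀, fun ν T hν hT u p hcl hLH hdec hax hgate hgrad => ?_⟩
  refine H ν T hν hT u p hcl hLH hdec hax hgate fun t ht x hx hx1 hcore => ?_
  have hs : 0 < T - t := by linarith [ht.2]
  have hd : DifferentiableAt ℝ (u t) x :=
    ((hcl.contDiff_velocity ht).differentiable (by simp)).differentiableAt
  have h1 : |radialVelocity (u t) x| ≤ cylRadius x * ‖fderiv ℝ (u t) x‖ :=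
    abs_radialVelocity_le_mul_norm_fderiv (hax t ht) hd
  have h2 : cylRadius x * ‖fderiv ℝ (u t) x‖ ≤ cylRadius x * (κ₀ / (T - t)) :=
    mul_le_mul_of_nonneg_left (hgrad t ht x hx hx1 hcore) (cylRadius_nonneg x)
  have h3 : cylRadius x * (κ₀ / (T - t)) = κ₀ * cylRadius x / (T - t) := by ring
  have h4 := (abs_le.1 (h1.trans (h2.trans_eq h3))).1
  linarith

/-! ## §2 The criteria on the stub's own hypothesis list (gate on a `δ`-tube, any constant) -/

/-- From the stub's gate to a unit-tube Reynolds gate.  In the standing class of the stub (classical on `[0,T)`,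
Leray–Hopf on `[0,T]` from `u 0`, bounded on closed sub-slabs, axisymmetric slices, rapidly decaying datum), a bound
`x₀u₀ + x₁u₁ = r u_r ≥ −Cν` on `{cylRadius < δ} × [0,T)` upgrades to `u_r ≥ −νΛ₀/r` on the whole punctured unit
tube `0 < r ≤ 1`, for some `Λ₀ > 0` depending on the solution: off the `δ`-tube the velocity is bounded up to `T`
(`offAxisBound`, Caffarelli–Kohn–Nirenberg), and `u_r ≥ −‖u‖`. [new] -/
theorem exists_unitTubeGate_of_tubeGate {ν T : ℝ} (hν : 0 < ν) (hT : 0 < T)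
    {u : ℝ → EuclideanSpace ℝ (Fin 3) → EuclideanSpace ℝ (Fin 3)} {p : ℝ → EuclideanSpace ℝ (Fin 3) → ℝ}
    (hcl : IsClassicalNSSolutionOn (Ico 0 T) ν 0 u p) (hLH : IsLerayHopfOn T ν 0 (u 0) u)
    (hbd : ∀ T' < T, ∃ M : ℝ, ∀ t ∈ Icc 0 T', ∀ x, ‖u t x‖ ≤ M) (hax : ∀ t ∈ Ico 0 T, IsAxisymmetric (u t))
    (hdec : HasRapidSpatialDecay (u 0))
    (hin : ∃ C δ : ℝ, 0 < δ ∧ ∀ t ∈ Ico 0 T, ∀ x : EuclideanSpace ℝ (Fin 3), cylRadius x < δ →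
      -(C * ν) ≤ x 0 * u t x 0 + x 1 * u t x 1) :
    ∃ Λ₀ : ℝ, 0 < Λ₀ ∧ ∀ t ∈ Ico 0 T, ∀ x : EuclideanSpace ℝ (Fin 3), 0 < cylRadius x → cylRadius x ≤ 1 →
      -(ν * Λ₀ / cylRadius x) ≤ radialVelocity (u t) x := by
  obtain ⟨C, δ, hδ, hgate⟩ := hin
  obtain ⟨M, hM⟩ := offAxisBound ν T hν hT u p hcl hLH hbd hax hdec δ hδ
  set Λ₀ : ℝ := max 1 (max C (max M 0 / ν)) with hΛ₀_def
  have hΛ0 : 0 < Λ₀ := lt_of_lt_of_le one_pos (le_max_left _ _)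
  have hΛC : C ≤ Λ₀ := (le_max_left _ _).trans (le_max_right _ _)
  have hΛM : max M 0 / ν ≤ Λ₀ := (le_max_right _ _).trans (le_max_right _ _)
  refine ⟨Λ₀, hΛ0, fun t ht x hx hx1 => ?_⟩
  rw [radialVelocity_eq_div']
  by_cases hxδ : cylRadius x < δ
  · -- inside the `δ`-tube: the stub's gate
    have h1 := hgate t ht x hxδ
    have h2 : -(ν * Λ₀ / cylRadius x) ≤ -(C * ν) / cylRadius x := by
      rw [neg_div]
      exact neg_le_neg (div_le_div_of_nonneg_right (by nlinarith) hx.le)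
    exact h2.trans (div_le_div_of_nonneg_right h1 hx.le)
  · -- off the `δ`-tube: the CKN bound `‖u‖ ≤ M`, `u_r ≥ -‖u‖ ≥ -M ≥ -(ν Λ₀)/r` (`r ≤ 1`)
    push Not at hxδ
    have hux : ‖u t x‖ ≤ max M 0 := (hM t ht x hxδ).trans (le_max_left _ _)
    have h1 := neg_cylRadius_mul_norm_le_radialMomentum x (u t x)
    have h2 : -(cylRadius x * max M 0) ≤ x 0 * u t x 0 + x 1 * u t x 1 := by
      nlinarith [cylRadius_nonneg x]
    have h3 : -(ν * Λ₀ / cylRadius x) ≤ -(cylRadius x * max M 0) / cylRadius x := by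
      rw [neg_div]
      refine neg_le_neg (div_le_div_of_nonneg_right ?_ hx.le)
      have h4 : max M 0 ≤ ν * Λ₀ := by
        rw [div_le_iff₀ hν] at hΛM; linarith
      have h5 : cylRadius x * max M 0 ≤ 1 * max M 0 :=
        mul_le_mul_of_nonneg_right hx1 (le_max_right _ _)
      linarith
    exact h3.trans (div_le_div_of_nonneg_right h2 hx.le)

/-- **The stub ⟨19059⟩ reduced to core radial compression.** On the exact hypothesis list of
`stub_oneSidedRadialCriterion` (standing class; `r u_r ≥ −Cν` on `{cylRadius < δ} × [0,T)` for SOME `C`, `δ > 0` —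
ANY constant, in particular the open regime `C ≥ 2`): there are `ξ₀, κ₀ > 0` (depending on the solution) such that
the one-sided radial strain bound `u_r ≥ −κ₀ r/(T−t)` on the parabolic core `{0 < r < ξ₀√(ν(T−t)), r ≤ 1}` implies
`HasSmoothExtensionPast ν 0 u T`.  (`exists_unitTubeGate_of_tubeGate` + `exists_coreWidth_strainRate`.) [new] -/
theorem oneSidedRadialCriterion_of_coreStrain :
    ∀ (ν T : ℝ), 0 < ν → 0 < T →
      ∀ (u : ℝ → EuclideanSpace ℝ (Fin 3) → EuclideanSpace ℝ (Fin 3)) (p : ℝ → EuclideanSpace ℝ (Fin 3) → ℝ),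
      IsClassicalNSSolutionOn (Ico 0 T) ν 0 u p → IsLerayHopfOn T ν 0 (u 0) u →
      (∀ T' < T, ∃ M : ℝ, ∀ t ∈ Icc 0 T', ∀ x, ‖u t x‖ ≤ M) → (∀ t ∈ Ico 0 T, IsAxisymmetric (u t)) →
      HasRapidSpatialDecay (u 0) →
      (∃ C δ : ℝ, 0 < δ ∧ ∀ t ∈ Ico 0 T, ∀ x : EuclideanSpace ℝ (Fin 3), cylRadius x < δ →
        -(C * ν) ≤ x 0 * u t x 0 + x 1 * u t x 1) →
      ∃ ξ₀ κ₀ : ℝ, 0 < ξ₀ ∧ 0 < κ₀ ∧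
        ((∀ t ∈ Ico 0 T, ∀ x : EuclideanSpace ℝ (Fin 3), 0 < cylRadius x → cylRadius x ≤ 1 →
            cylRadius x < ξ₀ * √(ν * (T - t)) → -(κ₀ * cylRadius x / (T - t)) ≤ radialVelocity (u t) x) →
          HasSmoothExtensionPast ν 0 u T) := by
  intro ν T hν hT u p hcl hLH hbd hax hdec hin
  obtain ⟨Λ₀, hΛ0, hgate⟩ := exists_unitTubeGate_of_tubeGate hν hT hcl hLH hbd hax hdec hin
  obtain ⟨ξ₀, κ₀, hξ₀, hκ₀, H⟩ := exists_coreWidth_strainRate hΛ0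
  exact ⟨ξ₀, κ₀, hξ₀, hκ₀, fun hstrain => H ν T hν hT u p hcl hLH hdec hax hgate hstrain⟩

/-- **The stub ⟨19059⟩ reduced to a Type-I gradient bound in the parabolic core.** Same hypothesis list; the core
hypothesis is now `‖fderiv ℝ (u t) x‖ ≤ κ₀/(T−t)` at the points `0 < r < ξ₀√(ν(T−t))`, `r ≤ 1`.
(`exists_unitTubeGate_of_tubeGate` + `exists_coreWidth_gradientRate`.) [new] -/
theorem oneSidedRadialCriterion_of_coreGradient :
    ∀ (ν T : ℝ), 0 < ν → 0 < T →
      ∀ (u : ℝ → EuclideanSpace ℝ (Fin 3) → EuclideanSpace ℝ (Fin 3)) (p : ℝ → EuclideanSpace ℝ (Fin 3) → ℝ),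
      IsClassicalNSSolutionOn (Ico 0 T) ν 0 u p → IsLerayHopfOn T ν 0 (u 0) u →
      (∀ T' < T, ∃ M : ℝ, ∀ t ∈ Icc 0 T', ∀ x, ‖u t x‖ ≤ M) → (∀ t ∈ Ico 0 T, IsAxisymmetric (u t)) →
      HasRapidSpatialDecay (u 0) →
      (∃ C δ : ℝ, 0 < δ ∧ ∀ t ∈ Ico 0 T, ∀ x : EuclideanSpace ℝ (Fin 3), cylRadius x < δ →
        -(C * ν) ≤ x 0 * u t x 0 + x 1 * u t x 1) →
      ∃ ξ₀ κ₀ : ℝ, 0 < ξ₀ ∧ 0 < κ₀ ∧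
        ((∀ t ∈ Ico 0 T, ∀ x : EuclideanSpace ℝ (Fin 3), 0 < cylRadius x → cylRadius x ≤ 1 →
            cylRadius x < ξ₀ * √(ν * (T - t)) → ‖fderiv ℝ (u t) x‖ ≤ κ₀ / (T - t)) →
          HasSmoothExtensionPast ν 0 u T) := by
  intro ν T hν hT u p hcl hLH hbd hax hdec hin
  obtain ⟨Λ₀, hΛ0, hgate⟩ := exists_unitTubeGate_of_tubeGate hν hT hcl hLH hbd hax hdec hin
  obtain ⟨ξ₀, κ₀, hξ₀, hκ₀, H⟩ := exists_coreWidth_gradientRate hΛ0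
  exact ⟨ξ₀, κ₀, hξ₀, hκ₀, fun hgrad => H ν T hν hT u p hcl hLH hdec hax hgate hgrad⟩

/-! ## §3 Blow-up reading -/

/-- **Blow-up under the gate forces Type-I-rate radial compression inside the parabolic core.** In the standing
class of the stub, under its gate `r u_r ≥ −Cν` on `{cylRadius < δ} × [0,T)` (any `C`), a solution that does NOT
extend smoothly past `T` has, for the constants `ξ₀, κ₀ > 0` of `oneSidedRadialCriterion_of_coreStrain`, a time
`t ∈ [0,T)` and a point `x` of the parabolic core (`0 < r < ξ₀√(ν(T−t))`, `r ≤ 1`) with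
`u_r(t,x) < −κ₀ r/(T−t)` (one-sided radial strain beyond the Type-I rate) and `‖∇u(t,x)‖ > κ₀/(T−t)`.
Contrapositive of §2 (the gradient clause from `|u_r| ≤ r‖∇u‖`). [new] -/
theorem exists_coreCompression_of_not_hasSmoothExtensionPast {ν T : ℝ} (hν : 0 < ν) (hT : 0 < T)
    {u : ℝ → EuclideanSpace ℝ (Fin 3) → EuclideanSpace ℝ (Fin 3)} {p : ℝ → EuclideanSpace ℝ (Fin 3) → ℝ}
    (hcl : IsClassicalNSSolutionOn (Ico 0 T) ν 0 u p) (hLH : IsLerayHopfOn T ν 0 (u 0) u)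
    (hbd : ∀ T' < T, ∃ M : ℝ, ∀ t ∈ Icc 0 T', ∀ x, ‖u t x‖ ≤ M) (hax : ∀ t ∈ Ico 0 T, IsAxisymmetric (u t))
    (hdec : HasRapidSpatialDecay (u 0))
    (hin : ∃ C δ : ℝ, 0 < δ ∧ ∀ t ∈ Ico 0 T, ∀ x : EuclideanSpace ℝ (Fin 3), cylRadius x < δ →
      -(C * ν) ≤ x 0 * u t x 0 + x 1 * u t x 1)
    (hno : ¬ HasSmoothExtensionPast ν 0 u T) :
    ∃ ξ₀ κ₀ : ℝ, 0 < ξ₀ ∧ 0 < κ₀ ∧ ∃ t ∈ Ico 0 T, ∃ x : EuclideanSpace ℝ (Fin 3),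
      0 < cylRadius x ∧ cylRadius x ≤ 1 ∧ cylRadius x < ξ₀ * √(ν * (T - t)) ∧
      radialVelocity (u t) x < -(κ₀ * cylRadius x / (T - t)) ∧ κ₀ / (T - t) < ‖fderiv ℝ (u t) x‖ := by
  obtain ⟨ξ₀, κ₀, hξ₀, hκ₀, H⟩ := oneSidedRadialCriterion_of_coreStrain ν T hν hT u p hcl hLH hbd hax hdec hin
  refine ⟨ξ₀, κ₀, hξ₀, hκ₀, ?_⟩
  by_contra hcon
  push Not at hcon
  refine hno (H fun t ht x hx hx1 hcore => ?_)
  by_contra hlt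
  push Not at hlt
  -- then the gradient is also beyond the Type-I rate at `(t, x)`, contradicting `hcon`
  have hs : 0 < T - t := by linarith [ht.2]
  have hd : DifferentiableAt ℝ (u t) x :=
    ((hcl.contDiff_velocity ht).differentiable (by simp)).differentiableAt
  have h1 : |radialVelocity (u t) x| ≤ cylRadius x * ‖fderiv ℝ (u t) x‖ :=
    abs_radialVelocity_le_mul_norm_fderiv (hax t ht) hd
  have h2 : κ₀ * cylRadius x / (T - t) < cylRadius x * ‖fderiv ℝ (u t) x‖ := by
    have := (abs_le.1 h1).1
    linarith
  have h3 : κ₀ / (T - t) < ‖fderiv ℝ (u t) x‖ := by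
    by_contra h4
    push Not at h4
    have h5 : cylRadius x * ‖fderiv ℝ (u t) x‖ ≤ cylRadius x * (κ₀ / (T - t)) :=
      mul_le_mul_of_nonneg_left h4 (cylRadius_nonneg x)
    have h6 : cylRadius x * (κ₀ / (T - t)) = κ₀ * cylRadius x / (T - t) := by ring
    linarith
  exact absurd h3 (not_lt.2 (hcon t ht x hx hx1 hcore hlt))

/-! ## §4 Explicit constants: `κ₀ = min (1/4) (1/(12Λ₀))`, core `{κ₀ r² < ν(T−t)}`

Unfolding the two-level gate at `d₀ = 1` (`p = 1`, `m = κ₀` in the Reynolds profile `D_{p,m}` of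
`RadialInflowCoreReynolds.hasSmoothExtensionPast_of_coreReynolds`) makes the trade-off between the size `Λ₀` of the
inflow Reynolds gate and the Type-I compression constant explicit: their product is `1/12` (for `Λ₀ ≥ 1/3`). -/

/-- **Explicit core-strain criterion.** Let `Λ₀ > 0` and `κ₀ = min (1/4) (1/(12Λ₀))`.  For `ν, T > 0` and a classical
solution on `[0,T)` at viscosity `ν`, Leray–Hopf from a rapidly decaying datum, with axisymmetric slices: if on the unit
tube `0 < r ≤ 1` the inflow Reynolds number is `≤ Λ₀` (`u_r ≥ −νΛ₀/r`), and at the points of the unit tube with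
`κ₀ r² < ν(T−t)` (the parabolic core of width `1/√κ₀ = √(max 4 (12Λ₀))` in the similarity variable) the one-sided
radial strain bound `u_r ≥ −κ₀ r/(T−t)` holds, then the solution extends smoothly past `T`.  Proof: the Reynolds
profile `D_{1,κ₀}(ξ)` is `≥ 1 ≥ κ₀ξ²` on the core `κ₀ξ² < 1` (`coreReynolds_ge`) and `≥ 1/(12κ₀) ≥ Λ₀` outside it
(`coreReynolds_large`, `ξ² ≥ 1/κ₀ ≥ 4`). [new] -/
theorem hasSmoothExtensionPast_of_gate_of_coreStrain {Λ₀ ν T : ℝ} (hΛ : 0 < Λ₀) (hν : 0 < ν) (hT : 0 < T)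
    {u : ℝ → EuclideanSpace ℝ (Fin 3) → EuclideanSpace ℝ (Fin 3)} {p : ℝ → EuclideanSpace ℝ (Fin 3) → ℝ}
    (hcl : IsClassicalNSSolutionOn (Ico 0 T) ν 0 u p) (hLH : IsLerayHopfOn T ν 0 (u 0) u)
    (hdec : HasRapidSpatialDecay (u 0)) (hax : ∀ t ∈ Ico 0 T, IsAxisymmetric (u t))
    (hgate : ∀ t ∈ Ico 0 T, ∀ x : EuclideanSpace ℝ (Fin 3), 0 < cylRadius x → cylRadius x ≤ 1 →
      -(ν * Λ₀ / cylRadius x) ≤ radialVelocity (u t) x)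
    (hstrain : ∀ t ∈ Ico 0 T, ∀ x : EuclideanSpace ℝ (Fin 3), 0 < cylRadius x → cylRadius x ≤ 1 →
      min (1 / 4) (1 / (12 * Λ₀)) * cylRadius x ^ 2 < ν * (T - t) →
      -(min (1 / 4) (1 / (12 * Λ₀)) * cylRadius x / (T - t)) ≤ radialVelocity (u t) x) :
    HasSmoothExtensionPast ν 0 u T := by
  set m : ℝ := min (1 / 4) (1 / (12 * Λ₀)) with hm_def
  have hm0 : 0 < m := lt_min (by norm_num) (by positivity)
  have hm4 : m ≤ 1 / 4 := min_le_left _ _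
  have hmΛ : m ≤ 1 / (12 * Λ₀) := min_le_right _ _
  have hmq : m < 1 / 2 := by linarith
  have h2m : 2 * m ≤ 1 := by linarith
  have hΛle : Λ₀ ≤ 1 / (12 * m) := by
    rw [le_div_iff₀ (by positivity)]
    have := (le_div_iff₀ (by positivity : (0 : ℝ) < 12 * Λ₀)).1 hmΛ
    linarith
  refine hasSmoothExtensionPast_of_coreReynolds (p₀ := 1) (m := m) one_pos one_lt_two hm0 hmq h2m hν hT hcl
    hLH hdec hax fun t ht x hx hx1 => ?_
  have hs : 0 < T - t := by linarith [ht.2]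
  have hνs : 0 < ν * (T - t) := mul_pos hν hs
  have hsq : 0 < √(ν * (T - t)) := Real.sqrt_pos.2 hνs
  set ξ : ℝ := cylRadius x / √(ν * (T - t)) with hξ_def
  have hξsq : ξ ^ 2 = cylRadius x ^ 2 / (ν * (T - t)) := by
    rw [hξ_def, div_pow, Real.sq_sqrt hνs.le]
  set D : ℝ := (1 * (2 - 1) + (9 / 2 * 1 - m - 4 * 1 * m) * ξ ^ 2 + (3 * m + 1 / 2 - 4 * m ^ 2) * ξ ^ 4)
      / ((1 + ξ ^ 2) * (1 + 2 * m * ξ ^ 2)) with hD_def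
  have hDge : 2 - 1 ≤ D := coreReynolds_ge one_pos hm0.le hmq.le ξ
  show -(ν * D / cylRadius x) ≤ radialVelocity (u t) x
  by_cases hcase : m * cylRadius x ^ 2 < ν * (T - t)
  · -- in the core: `u_r ≥ -(m r/(T-t)) ≥ -(ν/r) ≥ -(ν D/r)`
    have h1 := hstrain t ht x hx hx1 hcase
    have h3 : m * cylRadius x / (T - t) ≤ ν * D / cylRadius x := by
      rw [div_le_div_iff₀ hs hx]
      have h4 : m * cylRadius x * cylRadius x = m * cylRadius x ^ 2 := by ring
      rw [h4]
      have h5 : ν * (T - t) ≤ ν * D * (T - t) := by nlinarith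
      linarith
    linarith
  · -- outside the core: `ξ² ≥ 1/m ≥ 4`, so `D ≥ 1/(12 m) ≥ Λ₀`
    push Not at hcase
    have h1 := hgate t ht x hx hx1
    have hξq : 1 / m ≤ ξ ^ 2 := by
      rw [hξsq, div_le_div_iff₀ hm0 hνs]
      linarith
    have hξ1 : 1 ≤ ξ ^ 2 := le_trans (by rw [le_div_iff₀ hm0]; linarith) hξq
    have hDlarge : 1 / (12 * m) ≤ D := coreReynolds_large one_pos hm0 hm4 hmq hξ1 hξq
    have h2 : ν * Λ₀ / cylRadius x ≤ ν * D / cylRadius x := by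
      apply div_le_div_of_nonneg_right _ hx.le
      apply mul_le_mul_of_nonneg_left _ hν.le
      linarith
    linarith

/-- **Explicit blow-up reading.** In the class of `hasSmoothExtensionPast_of_gate_of_coreStrain`, under the unit-tube
gate `u_r ≥ −νΛ₀/r`, a solution that does NOT extend past `T` has, at some `t ∈ [0,T)` and some point with
`0 < r ≤ 1`, `κ₀ r² < ν(T−t)` (`κ₀ = min (1/4) (1/(12Λ₀))`), radial compression `u_r < −κ₀ r/(T−t)`: inflow Reynolds
gate `Λ₀` times Type-I compression constant `κ₀` is pinned at `min (Λ₀/4) (1/12)`. [new] -/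
theorem exists_coreCompression_explicit_of_not_hasSmoothExtensionPast {Λ₀ ν T : ℝ} (hΛ : 0 < Λ₀) (hν : 0 < ν)
    (hT : 0 < T) {u : ℝ → EuclideanSpace ℝ (Fin 3) → EuclideanSpace ℝ (Fin 3)} {p : ℝ → EuclideanSpace ℝ (Fin 3) → ℝ}
    (hcl : IsClassicalNSSolutionOn (Ico 0 T) ν 0 u p) (hLH : IsLerayHopfOn T ν 0 (u 0) u)
    (hdec : HasRapidSpatialDecay (u 0)) (hax : ∀ t ∈ Ico 0 T, IsAxisymmetric (u t))
    (hgate : ∀ t ∈ Ico 0 T, ∀ x : EuclideanSpace ℝ (Fin 3), 0 < cylRadius x → cylRadius x ≤ 1 →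
      -(ν * Λ₀ / cylRadius x) ≤ radialVelocity (u t) x)
    (hno : ¬ HasSmoothExtensionPast ν 0 u T) :
    ∃ t ∈ Ico 0 T, ∃ x : EuclideanSpace ℝ (Fin 3), 0 < cylRadius x ∧ cylRadius x ≤ 1 ∧
      min (1 / 4) (1 / (12 * Λ₀)) * cylRadius x ^ 2 < ν * (T - t) ∧
      radialVelocity (u t) x < -(min (1 / 4) (1 / (12 * Λ₀)) * cylRadius x / (T - t)) := by
  by_contra hcon
  push Not at hcon
  exact hno (hasSmoothExtensionPast_of_gate_of_coreStrain hΛ hν hT hcl hLH hdec hax hgate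
    fun t ht x hx hx1 hcore => hcon t ht x hx hx1 hcore)


end Summit.NavierStokesRegularity.NavierStokesRegularity.Theorems.RadialInflowCoreStrain

end
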